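import Summits.QuantumFields.QCD.Theses.SpectralDefectExtinction

/-!
# `TipPricing` (stmt-QuantumFields-8967) — line `coercivity-at-clean-edge` (crux-strategist, 2026-08-17)

Crux: `TipPricing := TipNoBinding → WegnerEstimate → WindowExtinction`, `WindowExtinction` = SD⁺ (stmt-18063, route rev ≥ 9:
mass scaling, asymptotic scaling, CAP, BRANCH, EXTINCT (a)+(b), TIGHT⁺).

THE CUT.  Every earlier line died either on a junk witness (killed by CAP + TIGHT⁺) or at a single stub equal to SD⁺ in
some format.  This line cuts the crux ALONG THE WEGNER SEAM instead: the only clause of SD⁺ on which the crux's hypothesis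
`WegnerEstimate` (a landing law for eigenvalues of the HERMITIAN operator `γ₅ D_W(m₀)` in a sliding window) can act is
clause (b), the coercivity window `|λ(γ₅ D_W(U, m_f(k), 1))| < c a_k m_f/Z_k`.  So:

* `stub_tightCleanEdge` — the TRUNK (crux-sized; = the junk-free content SD⁺ shares with stmt-18063, typed at MINIMAL
  volume growth `L_k = a_k^{-1-o(1)}`): a branched, scaling regularisation whose line is a clean tight edge — EXTINCT (a)
  (real modes of `D_W(U,0,1)` below every running mass: `≤ ε` per scheme torus, all tori ≥ the scheme's) and TIGHT⁺
  verbatim.  No window, no `c`.  Lead: DO NOT wave workers at it; it is to be promoted / co-staffed with 18063 (any SD⁺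
  line run at minimal growth proves it by dropping (b)).
* `stub_windowVectorEnergy` — deterministic, M: a unit vector `ψ` with `‖γ₅ D_W(U,m₀,1) ψ‖ ≤ w` has
  `|Re⟨ψ, D_W(U,m₀,1) ψ⟩| ≤ w` (Cauchy–Schwarz + `γ₅` unitary involution); with Wilson positivity
  `Re⟨ψ, D_W(U,0,1)ψ⟩ = ½ Σ_μ ‖∇^U_μ ψ‖²` (landed, Kato lever p114069 / `re_quadForm_wilsonDirac_eq`) every WINDOW vector at
  running mass `t_f = -m₀` is Kato-flat at level `2 t_f ± 2w` — the same smooth carriers as real strays.  The first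
  lemma of any pricing of clause (b); reusable by 18063.
* `stub_coercivityPricingOfEnergy` — the WEGNER LEAF given the energy lemma (XL, measure-level, NOT summit-class on its
  face): `WegnerEstimate →` for EVERY minimal-growth branched scaling regularisation and threshold `M₀` at which EXTINCT (a)
  and TIGHT⁺ hold for all `m > M₀`, the full EXTINCT clause (a)+(b) holds above some `M₁ ≥ M₀` with some `c > 0`.
  Content: near-real Krein-neutral pairs `x ± iy` of `D_W` (`x` below the edge, `|y| ≲ c a m/Z`) and pseudospectral
  pockets are as rare per scheme torus as real strays — Krein collision geometry of the `γ₅`-Hermitian pencil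
  (Gohberg–Lancaster–Rodman; route idea `krein-definite-dressing` L1), departure from normality on Kato-flat carriers,
  the landed coarea transfer of `WegnerEstimate` to sliding windows (p82841, p77973, p80144) as the landing factor,
  flavour-zero transfer to the `|det|` weights.

Composition `TipPricing_of` = the strategist's split glue (`Cruxes/TipPricing/TipPricingSplit.lean`,
`CleanEdgeSplit.tipPricing_of_subs`, inlined here as `glue` so the file is self-contained): trunk witness → leaf →
threshold raised to `M₁`, TIGHT⁺ restricted to probes `M > M₁`, cap `p = 2` from minimal growth at `q = 1`.
The same two statements are filed for `route edit --split TipPricing --into {TightCleanEdge, CoercivityPricing}`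
(children.json attached as evidence; the gate defers planner splits to a seat's final cycle).
-/

noncomputable section

namespace Summit.QuantumFields.QCD.Cruxes.TipPricing.CoercivityAtCleanEdge

open scoped BigOperators Topology Classical Matrix
open MeasureTheory Filter Matrix
open Literature.MathematicalPhysics.QuantumLattice Literature.MathematicalPhysics.QuantumFieldTheory
  Literature.Probability.LatticeModels
open Summit.QuantumFields.QCD.Theses.SpectralDefectExtinction

/-! ## Stubs -/

/-- STUB 1 (TRUNK, crux-sized; shared with stmt-18063 — promote / co-staff, do not wave): **a clean tight edge exists at
minimal volume growth.**  For `N_f ∈ {2,3}`: a mass-scaling, asymptotically scaling regularisation with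
`L_k ^ q ≤ a_k⁻¹ ^ (q+1)` eventually for every `q ≥ 1`, on the branch `-1 < m_crit(k)`, a threshold `M₀ ≥ 0`, and for
every `m > M₀`: EXTINCT (a) (real eigenvalues of `D_W(U,0,1)` below `-(m_crit(k) + a_k m_f/Z_k)`, phase-quenched,
`≤ ε ((2S+1)/(2L_k+1))⁴` on every torus `2S+1 ≥ 2L_k+1`, eventually) and TIGHT⁺ (verbatim from `WindowExtinction`). -/
theorem stub_tightCleanEdge : ∀ Nf : ℕ, (Nf = 2 ∨ Nf = 3) → ∃ reg : QCDRegularisation Nf, reg.HasMassScaling ∧ (reg.scheme 0 0 0).HasAsymptoticScaling ∧ (∀ q : ℕ, 0 < q → ∀ᶠ k : ℕ in Filter.atTop, (reg.L k : ℝ) ^ q ≤ (reg.a k)⁻¹ ^ (q + 1)) ∧ (∀ᶠ k : ℕ in Filter.atTop, -1 < reg.mcrit k) ∧ ∃ M₀ : ℝ, 0 ≤ M₀ ∧ ∀ m : Fin Nf → ℝ, (∀ f, M₀ < m f) → (∀ ε : ℝ, 0 < ε → ∀ᶠ k : ℕ in Filter.atTop, ∀ S : ℕ, reg.L k ≤ S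 → (∫ U, (∑ f : Fin Nf, (Multiset.countP (fun z : ℂ => z.im = 0 ∧ z.re < -(reg.mcrit k + reg.a k * m f / reg.Zm k)) (wilsonDirac (fundamentalRep (Fin 3)) U 0 1).charpoly.roots : ℝ)) * ∏ f : Fin Nf, ‖fermionDet (wilsonDirac (fundamentalRep (Fin 3)) U (reg.mcrit k + reg.a k * m f / reg.Zm k) 1)‖ ∂(wilsonMeasure (d := 4) (L := 2 * S + 1) (fundamentalRep (Fin 3)) (reg.β k))) / (∫ U, ∏ f : Fin Nf, ‖fermionDet (wilsonDirac (fundamentalRep (Fin 3)) U (reg.mcrit k + reg.a k * m f / reg.Zm k) 1)‖ ∂(wilsonMeasure (d := 4) (L := 2 * S + 1) (fundamentalRep (Fin 3)) (reg.β k))) ≤ ε * ((2 * S + 1 : ℝ) / (2 * reg.L k + 1)) ^ 4) ∧ (∃ η : ℝ, 0 < η ∧ ∀ M : ℝ, M₀ < M → ∀ᶠ k : ℕ in Filter.atTop, max 1 (η * (reg.a k * (2 * reg.L k + 1 : ℝ)) ^ 2) ≤ (∫ U, (|(Multiset.countP (fun z : ℂ => z.re < 0) (spinorLift gammaFive * wilsonDirac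 (fundamentalRep (Fin 3)) U (reg.mcrit k - reg.a k * M / reg.Zm k) 1).charpoly.roots : ℝ) - 6 * (2 * reg.L k + 1 : ℝ) ^ 4|) * ∏ f : Fin Nf, ‖fermionDet (wilsonDirac (fundamentalRep (Fin 3)) U (reg.mcrit k + reg.a k * m f / reg.Zm k) 1)‖ ∂(wilsonMeasure (d := 4) (L := 2 * reg.L k + 1) (fundamentalRep (Fin 3)) (reg.β k))) / (∫ U, ∏ f : Fin Nf, ‖fermionDet (wilsonDirac (fundamentalRep (Fin 3)) U (reg.mcrit k + reg.a k * m f / reg.Zm k) 1)‖ ∂(wilsonMeasure (d := 4) (L := 2 * reg.L k + 1) (fundamentalRep (Fin 3)) (reg.β k)))) := by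
  sorry

/-- STUB 2 (deterministic, M): **window vectors are Kato-flat.**  If `‖γ₅ D_W(U,m₀,1) ψ‖² ≤ w² ‖ψ‖²` then
`|Re⟨ψ, D_W(U,m₀,1) ψ⟩| ≤ w ‖ψ‖²`: `Re⟨ψ, Dψ⟩ = Re⟨γ₅ψ, γ₅Dψ⟩`, Cauchy–Schwarz, `‖γ₅ψ‖ = ‖ψ‖`
(`spinorLift gammaFive` is a unitary involution: `gammaFive = diag(1,1,-1,-1)`).  Combined with the landed identity
`Re⟨ψ, D_W(U,0,1)ψ⟩ = ½ Σ_μ ‖∇^U_μ ψ‖²` it puts every coercivity-window vector at running mass `-m₀` on the covariant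
Dirichlet shell `|½ Σ‖∇ψ‖² + m₀‖ψ‖²| ≤ w‖ψ‖²`. [folklore] -/
theorem stub_windowVectorEnergy : ∀ (L : ℕ) [NeZero L] (U : GaugeConfig 4 L ↥(Matrix.specialUnitaryGroup (Fin 3) ℂ)) (m₀ w : ℝ) (ψ : TorusSite 4 L × Fin 3 × Fin 4 → ℂ), 0 ≤ w → (∑ p, ‖((spinorLift gammaFive * wilsonDirac (fundamentalRep (Fin 3)) U m₀ 1) *ᵥ ψ) p‖ ^ 2) ≤ w ^ 2 * ∑ p, ‖ψ p‖ ^ 2 → |(star ψ ⬝ᵥ (wilsonDirac (fundamentalRep (Fin 3)) U m₀ 1 *ᵥ ψ)).re| ≤ w * ∑ p, ‖ψ p‖ ^ 2 := by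
  sorry

/-- STUB 3 (WEGNER LEAF, XL): **the landing law prices the coercivity window at a clean tight edge**, given the energy
lemma.  `WegnerEstimate →` for every `N_f ∈ {2,3}`, every mass-scaling, asymptotically scaling, minimal-growth, branched
`reg` and every `M₀ ≥ 0` such that EXTINCT (a) ∧ TIGHT⁺ hold for all `m > M₀`, there are `M₁ ≥ M₀` and `c > 0` with the full
EXTINCT clause (a)+(b) of `WindowExtinction` for all `m > M₁`.  Minimal growth makes the ∀-statement safe: a defect
population dies per scheme torus iff its rate per site is `o(a_k^{4+o(1)})`, i.e. vanishes per PHYSICAL volume. -/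
theorem stub_coercivityPricingOfEnergy : (∀ (L : ℕ) [NeZero L] (U : GaugeConfig 4 L ↥(Matrix.specialUnitaryGroup (Fin 3) ℂ)) (m₀ w : ℝ) (ψ : TorusSite 4 L × Fin 3 × Fin 4 → ℂ), 0 ≤ w → (∑ p, ‖((spinorLift gammaFive * wilsonDirac (fundamentalRep (Fin 3)) U m₀ 1) *ᵥ ψ) p‖ ^ 2) ≤ w ^ 2 * ∑ p, ‖ψ p‖ ^ 2 → |(star ψ ⬝ᵥ (wilsonDirac (fundamentalRep (Fin 3)) U m₀ 1 *ᵥ ψ)).re| ≤ w * ∑ p, ‖ψ p‖ ^ 2) → WegnerEstimate → ∀ Nf : ℕ, (Nf = 2 ∨ Nf = 3) → ∀ reg : QCDRegularisation Nf, reg.HasMassScaling → (reg.scheme 0 0 0).HasAsymptoticScaling → (∀ q : ℕ, 0 < q → ∀ᶠ k : ℕ in Filter.atTop, (reg.L k : ℝ) ^ q ≤ (reg.a k)⁻¹ ^ (q + 1)) → (∀ᶠ k : ℕ in Filter.atTop, -1 < reg.mcrit k) → ∀ M₀ : ℝ, 0 ≤ M₀ → (∀ m : Fin Nf → ℝ,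 (∀ f, M₀ < m f) → (∀ ε : ℝ, 0 < ε → ∀ᶠ k : ℕ in Filter.atTop, ∀ S : ℕ, reg.L k ≤ S → (∫ U, (∑ f : Fin Nf, (Multiset.countP (fun z : ℂ => z.im = 0 ∧ z.re < -(reg.mcrit k + reg.a k * m f / reg.Zm k)) (wilsonDirac (fundamentalRep (Fin 3)) U 0 1).charpoly.roots : ℝ)) * ∏ f : Fin Nf, ‖fermionDet (wilsonDirac (fundamentalRep (Fin 3)) U (reg.mcrit k + reg.a k * m f / reg.Zm k) 1)‖ ∂(wilsonMeasure (d := 4) (L := 2 * S + 1) (fundamentalRep (Fin 3)) (reg.β k))) / (∫ U, ∏ f : Fin Nf, ‖fermionDet (wilsonDirac (fundamentalRep (Fin 3)) U (reg.mcrit k + reg.a k * m f / reg.Zm k) 1)‖ ∂(wilsonMeasure (d := 4) (L := 2 * S + 1) (fundamentalRep (Fin 3)) (reg.β k))) ≤ ε * ((2 * S + 1 : ℝ) / (2 * reg.L k + 1)) ^ 4) ∧ (∃ η : ℝ, 0 < η ∧ ∀ M : ℝ, M₀ < M → ∀ᶠ k : ℕ in Filter.atTop, max 1 (η * (reg.a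 k * (2 * reg.L k + 1 : ℝ)) ^ 2) ≤ (∫ U, (|(Multiset.countP (fun z : ℂ => z.re < 0) (spinorLift gammaFive * wilsonDirac (fundamentalRep (Fin 3)) U (reg.mcrit k - reg.a k * M / reg.Zm k) 1).charpoly.roots : ℝ) - 6 * (2 * reg.L k + 1 : ℝ) ^ 4|) * ∏ f : Fin Nf, ‖fermionDet (wilsonDirac (fundamentalRep (Fin 3)) U (reg.mcrit k + reg.a k * m f / reg.Zm k) 1)‖ ∂(wilsonMeasure (d := 4) (L := 2 * reg.L k + 1) (fundamentalRep (Fin 3)) (reg.β k))) / (∫ U, ∏ f : Fin Nf, ‖fermionDet (wilsonDirac (fundamentalRep (Fin 3)) U (reg.mcrit k + reg.a k * m f / reg.Zm k) 1)‖ ∂(wilsonMeasure (d := 4) (L := 2 * reg.L k + 1) (fundamentalRep (Fin 3)) (reg.β k))))) → ∃ M₁ : ℝ, M₀ ≤ M₁ ∧ ∃ c : ℝ, 0 < c ∧ ∀ m : Fin Nf → ℝ, (∀ f, M₁ < m f) → (∀ ε : ℝ, 0 < ε → ∀ᶠ k : ℕ in Filter.atTop, ∀ S : ℕ, reg.L k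 ≤ S → (∫ U, ((∑ f : Fin Nf, ((Multiset.countP (fun z : ℂ => z.im = 0 ∧ z.re < -(reg.mcrit k + reg.a k * m f / reg.Zm k)) (wilsonDirac (fundamentalRep (Fin 3)) U 0 1).charpoly.roots : ℝ) + (Multiset.countP (fun z : ℂ => |z.re| < c * (reg.a k * m f / reg.Zm k)) (spinorLift gammaFive * wilsonDirac (fundamentalRep (Fin 3)) U (reg.mcrit k + reg.a k * m f / reg.Zm k) 1).charpoly.roots : ℝ)))) * ∏ f : Fin Nf, ‖fermionDet (wilsonDirac (fundamentalRep (Fin 3)) U (reg.mcrit k + reg.a k * m f / reg.Zm k) 1)‖ ∂(wilsonMeasure (d := 4) (L := 2 * S + 1) (fundamentalRep (Fin 3)) (reg.β k))) / (∫ U, ∏ f : Fin Nf, ‖fermionDet (wilsonDirac (fundamentalRep (Fin 3)) U (reg.mcrit k + reg.a k * m f / reg.Zm k) 1)‖ ∂(wilsonMeasure (d := 4) (L := 2 * S + 1) (fundamentalRep (Fin 3)) (reg.β k))) ≤ ε * ((2 * S + 1 : ℝ) / (2 * reg.L k + 1)) ^ 4) := by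
  sorry

/-! ## Glue (sorry-free; = `CleanEdgeSplit.tipPricing_of_subs`) -/

/-- Trunk → Wegner leaf → `TipPricing`: logic over the verbatim clause texts (threshold raised to `M₁`, TIGHT⁺ restricted to
probes `M > M₁ ≥ M₀`, SD⁺'s cap exponent `p = 2` read off minimal growth at `q = 1`; `TipNoBinding` discarded,
`WegnerEstimate` consumed by the leaf). -/
theorem glue
    (hT : ∀ Nf : ℕ, (Nf = 2 ∨ Nf = 3) → ∃ reg : QCDRegularisation Nf, reg.HasMassScaling ∧ (reg.scheme 0 0 0).HasAsymptoticScaling ∧ (∀ q : ℕ, 0 < q → ∀ᶠ k : ℕ in Filter.atTop, (reg.L k : ℝ) ^ q ≤ (reg.a k)⁻¹ ^ (q + 1)) ∧ (∀ᶠ k : ℕ in Filter.atTop, -1 < reg.mcrit k) ∧ ∃ M₀ : ℝ, 0 ≤ M₀ ∧ ∀ m : Fin Nf → ℝ, (∀ f, M₀ < m f) → (∀ ε : ℝ, 0 < ε → ∀ᶠ k : ℕ in Filter.atTop, ∀ S : ℕ, reg.L k ≤ S → (∫ U, (∑ f : Fin Nf, (Multiset.countP (fun z : ℂ => z.im = 0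 ∧ z.re < -(reg.mcrit k + reg.a k * m f / reg.Zm k)) (wilsonDirac (fundamentalRep (Fin 3)) U 0 1).charpoly.roots : ℝ)) * ∏ f : Fin Nf, ‖fermionDet (wilsonDirac (fundamentalRep (Fin 3)) U (reg.mcrit k + reg.a k * m f / reg.Zm k) 1)‖ ∂(wilsonMeasure (d := 4) (L := 2 * S + 1) (fundamentalRep (Fin 3)) (reg.β k))) / (∫ U, ∏ f : Fin Nf, ‖fermionDet (wilsonDirac (fundamentalRep (Fin 3)) U (reg.mcrit k + reg.a k * m f / reg.Zm k) 1)‖ ∂(wilsonMeasure (d := 4) (L := 2 * S + 1) (fundamentalRep (Fin 3)) (reg.β k))) ≤ ε * ((2 * S + 1 : ℝ) / (2 * reg.L k + 1)) ^ 4) ∧ (∃ η : ℝ, 0 < η ∧ ∀ M : ℝ, M₀ < M → ∀ᶠ k : ℕ in Filter.atTop, max 1 (η * (reg.a k * (2 * reg.L k + 1 : ℝ)) ^ 2) ≤ (∫ U, (|(Multiset.countP (fun z : ℂ => z.re < 0) (spinorLift gammaFive * wilsonDirac (fundamentalRep (Fin 3)) U (reg.mcrit k - reg.a k * M / reg.Zm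 k) 1).charpoly.roots : ℝ) - 6 * (2 * reg.L k + 1 : ℝ) ^ 4|) * ∏ f : Fin Nf, ‖fermionDet (wilsonDirac (fundamentalRep (Fin 3)) U (reg.mcrit k + reg.a k * m f / reg.Zm k) 1)‖ ∂(wilsonMeasure (d := 4) (L := 2 * reg.L k + 1) (fundamentalRep (Fin 3)) (reg.β k))) / (∫ U, ∏ f : Fin Nf, ‖fermionDet (wilsonDirac (fundamentalRep (Fin 3)) U (reg.mcrit k + reg.a k * m f / reg.Zm k) 1)‖ ∂(wilsonMeasure (d := 4) (L := 2 * reg.L k + 1) (fundamentalRep (Fin 3)) (reg.β k)))))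
    (hB : WegnerEstimate → ∀ Nf : ℕ, (Nf = 2 ∨ Nf = 3) → ∀ reg : QCDRegularisation Nf, reg.HasMassScaling → (reg.scheme 0 0 0).HasAsymptoticScaling → (∀ q : ℕ, 0 < q → ∀ᶠ k : ℕ in Filter.atTop, (reg.L k : ℝ) ^ q ≤ (reg.a k)⁻¹ ^ (q + 1)) → (∀ᶠ k : ℕ in Filter.atTop, -1 < reg.mcrit k) → ∀ M₀ : ℝ, 0 ≤ M₀ → (∀ m : Fin Nf → ℝ, (∀ f, M₀ < m f) → (∀ ε : ℝ, 0 < ε → ∀ᶠ k : ℕ in Filter.atTop, ∀ S : ℕ, reg.L k ≤ S → (∫ U, (∑ f : Fin Nf, (Multiset.countP (fun z : ℂ => z.im = 0 ∧ z.re < -(reg.mcrit k + reg.a k * m f / reg.Zm k)) (wilsonDirac (fundamentalRep (Fin 3)) U 0 1).charpoly.roots : ℝ)) * ∏ f : Fin Nf, ‖fermionDet (wilsonDirac (fundamentalRep (Fin 3)) U (reg.mcrit k + reg.a k * m f / reg.Zm k) 1)‖ ∂(wilsonMeasure (d := 4) (L := 2 * S + 1) (fundamentalRep (Fin 3)) (reg.β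 k))) / (∫ U, ∏ f : Fin Nf, ‖fermionDet (wilsonDirac (fundamentalRep (Fin 3)) U (reg.mcrit k + reg.a k * m f / reg.Zm k) 1)‖ ∂(wilsonMeasure (d := 4) (L := 2 * S + 1) (fundamentalRep (Fin 3)) (reg.β k))) ≤ ε * ((2 * S + 1 : ℝ) / (2 * reg.L k + 1)) ^ 4) ∧ (∃ η : ℝ, 0 < η ∧ ∀ M : ℝ, M₀ < M → ∀ᶠ k : ℕ in Filter.atTop, max 1 (η * (reg.a k * (2 * reg.L k + 1 : ℝ)) ^ 2) ≤ (∫ U, (|(Multiset.countP (fun z : ℂ => z.re < 0) (spinorLift gammaFive * wilsonDirac (fundamentalRep (Fin 3)) U (reg.mcrit k - reg.a k * M / reg.Zm k) 1).charpoly.roots : ℝ) - 6 * (2 * reg.L k + 1 : ℝ) ^ 4|) * ∏ f : Fin Nf, ‖fermionDet (wilsonDirac (fundamentalRep (Fin 3)) U (reg.mcrit k + reg.a k * m f / reg.Zm k) 1)‖ ∂(wilsonMeasure (d := 4) (L := 2 * reg.L k + 1) (fundamentalRep (Fin 3)) (reg.β k))) / (∫ U, ∏ f : Fin Nf, ‖fermionDet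 (wilsonDirac (fundamentalRep (Fin 3)) U (reg.mcrit k + reg.a k * m f / reg.Zm k) 1)‖ ∂(wilsonMeasure (d := 4) (L := 2 * reg.L k + 1) (fundamentalRep (Fin 3)) (reg.β k))))) → ∃ M₁ : ℝ, M₀ ≤ M₁ ∧ ∃ c : ℝ, 0 < c ∧ ∀ m : Fin Nf → ℝ, (∀ f, M₁ < m f) → (∀ ε : ℝ, 0 < ε → ∀ᶠ k : ℕ in Filter.atTop, ∀ S : ℕ, reg.L k ≤ S → (∫ U, ((∑ f : Fin Nf, ((Multiset.countP (fun z : ℂ => z.im = 0 ∧ z.re < -(reg.mcrit k + reg.a k * m f / reg.Zm k)) (wilsonDirac (fundamentalRep (Fin 3)) U 0 1).charpoly.roots : ℝ) + (Multiset.countP (fun z : ℂ => |z.re| < c * (reg.a k * m f / reg.Zm k)) (spinorLift gammaFive * wilsonDirac (fundamentalRep (Fin 3)) U (reg.mcrit k + reg.a k * m f / reg.Zm k) 1).charpoly.roots : ℝ)))) * ∏ f : Fin Nf, ‖fermionDet (wilsonDirac (fundamentalRep (Fin 3)) U (reg.mcrit k + reg.a k * m f / reg.Zm k) 1)‖ ∂(wilsonMeasure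 (d := 4) (L := 2 * S + 1) (fundamentalRep (Fin 3)) (reg.β k))) / (∫ U, ∏ f : Fin Nf, ‖fermionDet (wilsonDirac (fundamentalRep (Fin 3)) U (reg.mcrit k + reg.a k * m f / reg.Zm k) 1)‖ ∂(wilsonMeasure (d := 4) (L := 2 * S + 1) (fundamentalRep (Fin 3)) (reg.β k))) ≤ ε * ((2 * S + 1 : ℝ) / (2 * reg.L k + 1)) ^ 4)) :
    TipPricing := by
  intro _ hW Nf hNf
  obtain ⟨reg, hms, has, hgr, hbr, M₀, hM₀, hTm⟩ := hT Nf hNf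
  obtain ⟨M₁, hM₀₁, c, hc, hE⟩ := hB hW Nf hNf reg hms has hgr hbr M₀ hM₀ hTm
  refine ⟨reg, hms, has, ⟨2, ?_⟩, hbr, M₁, le_trans hM₀ hM₀₁, c, hc, fun m hm => ⟨hE m hm, ?_⟩⟩
  · filter_upwards [hgr 1 one_pos] with k hk
    simpa using hk
  · have hm' : ∀ f, M₀ < m f := fun f => lt_of_le_of_lt hM₀₁ (hm f)
    obtain ⟨η, hη, hT'⟩ := (hTm m hm').2
    exact ⟨η, hη, fun M hM => hT' M (lt_of_le_of_lt hM₀₁ hM)⟩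

/-! ## Composition -/

/-- **The line's composition**: concludes the crux `TipPricing` BY NAME from the three stubs (sorries only inside
`stub_*`). -/
theorem TipPricing_of : TipPricing :=
  glue stub_tightCleanEdge (stub_coercivityPricingOfEnergy stub_windowVectorEnergy)

end Summit.QuantumFields.QCD.Cruxes.TipPricing.CoercivityAtCleanEdge

end
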